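import Summits.ResolutionOfSingularities.ResolutionOfSingularities.Theorems.FrobeniusClosingSteerBetaGlueFrame
import Summits.ResolutionOfSingularities.ResolutionOfSingularities.Theorems.FrobeniusClosingSteerBetaGluePurify
import Summits.ResolutionOfSingularities.ResolutionOfSingularities.Theorems.FrobeniusClosingSteerBetaGlueDownstairs
import Summits.ResolutionOfSingularities.ResolutionOfSingularities.Theorems.FrobeniusClosingSteerBetaHatLawWords
import Summits.ResolutionOfSingularities.ResolutionOfSingularities.Theorems.FrobeniusClosingSteerPrepDebtHatArithGlue
import HarnessLib

/-!
# Crux `Steer` (stmt-ResolutionOfSingularities-16345), chain W4.1, β-LEAF, K-β2♭ part (III-Y): the GLUE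
# `yLetterLawHat_of` — `PrepAttainHat → VertexTheoremTwHat → PreparedTransferYHat → YLetterLawHat` (def-free)

OURS (campaign `res-hironaka`, rung L ★L-G4, slot W4.1; statements about the route's own objects; they replace the
role of no printed item and are NOT statements of the manuscript under review [claim: Hironaka2017, status:
under-review]; AI review is weaker than expert review). Seat res-D-pv-003 (gen 7), K-β2♭ owner; GLUE (III) per
res-L0-w41-plan-1 RULING 276(a); the β-leaf's designed sorry `yLetterLawHat_of` (v18.4-J4 and successors).

`yLetterLawHat_of_words (hatt : PrepAttainHat) (hV : VertexTheoremTwHat) (hII : PreparedTransferYHat) : YLetterLawHat`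
(tree words of res-D-pv-035's `…BetaHatLawWords` p553853). The proof: attain a prepared representative (`hatt`), identify its
vertex with `v*` (`hV` + orbit invariance `isVStarTw_iff_of_isGaugeRepTw` + uniqueness); FRAME CORRECTION
(`frame_yCoeff_mem_maximalIdeal`, J5-b: the `y`-coefficients of the frame change are non-units, so the naive transform of the frame
is a downstairs frame); PURIFICATION (`exists_purified`, J5-a: the cleaning is trimmed into the near-point ideal, so the transform
is again an arithmetic stage datum); `hII` transfers preparedness; `hV` downstairs reads the star value; orbit invariance and uniqueness
downstairs give `α₁* = α*`, `β₁* = α* + β* − 1`.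

[cite: CossartJannsenSaito2020, Lemma 12.2] [cite: CossartPiltant2019, Prop. 2.1 and 2.6] No Theses file is imported; nothing here is
a route item or a registration.
-/

noncomputable section

-- `Summit.<S>.<S>.…` duplicates the summit name by design (single-problem summit).
set_option linter.dupNamespace false

namespace Summit.ResolutionOfSingularities.ResolutionOfSingularities.Theorems.SwitchingDichotomy.BetaHat

open IsLocalRing MvPolynomial
open Literature.AlgebraicGeometry.Resolution
open Literature.AlgebraicGeometry.Resolution.CossartPiltant (uPow uPow_mem_span_uPow minExponents)
open Summit.ResolutionOfSingularities.ResolutionOfSingularities.Theorems.SwitchingDichotomy.BetaPolygon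
open Summit.ResolutionOfSingularities.ResolutionOfSingularities.Theorems.SwitchingDichotomy.BetaPolygonMoves
  (isVStarTw_iff_of_isGaugeRepTw)
open Summit.ResolutionOfSingularities.ResolutionOfSingularities.Theorems.SwitchingDichotomy.BetaLetter (uPow_four range_four
  span_four_pow_eq_span_uPow)
open Summit.ResolutionOfSingularities.ResolutionOfSingularities.Theorems.SwitchingDichotomy.BetaNewton

/-- **GLUE (III-Y): the star-level `y`-law `YLetterLawHat` from `PrepAttainHat`, `VertexTheoremTwHat`, `PreparedTransferYHat`.**
See the module docstring. [cite: CossartJannsenSaito2020, Lemma 12.2] -/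
theorem yLetterLawHat_of_words (hatt : PrepAttainHat) (hV : VertexTheoremTwHat) (hII : PreparedTransferYHat) :
    YLetterLawHat := by
  intro S S₁ _ _ _ _ _ _ φ σ σ₁ x y z w u f x₁ z₁ w₁ u₁ f₁ d k α β α₁ β₁ hS hS₁ hodd h3 hA hY hrad hA₁ hVf hV₁
  classical
  have hS' := hS; have hS₁' := hS₁; have hA' := hA; have hA₁' := hA₁
  obtain ⟨-, hreg, -, hdim, hperf⟩ := hS'
  obtain ⟨-, hreg₁, -, hdim₁, -⟩ := hS₁'
  obtain ⟨hspan, ⟨a, b, ha, hb, hu⟩, Ψ, hΨ, hroot, hfΨ⟩ := hA'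
  obtain ⟨hspan₁, ⟨a₁, b₁, ha₁, hb₁, hu₁⟩, Ψ₁, hΨ₁, hroot₁, hfΨ₁⟩ := hA₁'
  obtain ⟨hσ, hσ₁, hcompat, hsurj, -, hx, hz, hw⟩ := hY
  haveI := hreg
  haveI := hreg₁
  haveI : IsDomain S₁ := isDomain_of_isRegularLocalRing S₁
  have hd : 0 < d := by omega
  have h2 : (2 : S) = 0 := by simpa using CharP.cast_eq_zero S 2
  have ht : IsRsopPart ![x, y, z, w] := isRsopPart_four hreg hdim hspan
  have ht₁ : IsRsopPart ![x₁, φ y, z₁, w₁] := isRsopPart_four hreg₁ hdim₁ hspan₁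
  -- ### the strict transform of `f` is `f₁`; `2k + b₁ = a + b + d`; the near-point region
  have hΨd := coeff_single_notMem_of_rootless hΨ (hroot 1 0 (Or.inl one_ne_zero))
  have hΨ₁d := coeff_single_notMem_of_rootless hΨ₁ (hroot₁ 1 0 (Or.inl one_ne_zero))
  have hfd : f ∈ maximalIdeal S ^ d := mem_pow_of_cone hspan hd hΨ hfΨ
  have hf₁d : f₁ ∈ maximalIdeal S₁ ^ d := mem_pow_of_cone hspan₁ hd hΨ₁ hfΨ₁
  have hcf := single_two_mem_minExponents_of_cone ht hspan hΨ hΨd hfΨ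
  have hcf₁ := single_two_mem_minExponents_of_cone ht₁ hspan₁ hΨ₁ hΨ₁d hfΨ₁
  obtain ⟨g, hg⟩ := exists_strictTransform φ hx hz hw (d := d) (f := f) (by rw [hspan]; exact hfd)
  have hgf : g * φ y ^ d = φ f := by rw [hg, mul_comm]
  obtain ⟨-, htr2⟩ := minExponents_strictTransform φ ht ht₁ hspan hspan₁ hx hz hw hfd hgf
  obtain ⟨ag, hag, hagle⟩ := htr2 _ hcf
  obtain ⟨k0, k1, -, -⟩ := (le_transport_iff _ ag d).mp hagle
  have hag0 : ag 0 = 0 := by simpa using k0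
  have hag1 : ag 1 = 0 := by simpa using k1
  obtain ⟨hgf₁, ha₁a, hk⟩ := strictTransform_eq_of_radicand φ ht₁ hx hu hu₁ hg hrad hag hag0 hag1 hcf₁ (by simp) (by simp)
  have hf : f₁ * φ y ^ d = φ f := by rw [hg, hgf₁, mul_comm]
  have hnear := forall_minExponents_nearY φ ht ht₁ hspan hspan₁ hx hz hw hfd hf hf₁d
  -- ### attain a prepared representative and identify its vertex with `v*`
  have hfin : ¬ AlphaStarGeTw u x y z w d (α + 1) f := by
    rintro ⟨z', w', f', hrep, hAl⟩
    have := hVf.2.1 z' w' f' (α + 1) hrep hAl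
    linarith
  obtain ⟨α', β', z', w', f', hrep, hAst', hprep', -⟩ := hatt S x y z w u f d (α + 1) hS hodd h3 hA hfin
  have hVrep := hV S x y z' w' u f' d α' β' hS hodd h3 hAst' hprep'
  obtain ⟨hαeq, hβeq⟩ := isVStarTw_unique hVf ((isVStarTw_iff_of_isGaugeRepTw hrep d α' β').mp hVrep)
  rw [hαeq, hβeq] at hprep'
  -- ### the frame change and the cleaning
  obtain ⟨hz'mem, hw'mem, q, hf'⟩ := hrep
  obtain ⟨c₁, c₂, hc⟩ := Ideal.mem_span_pair.mp hz'mem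
  obtain ⟨c₁', c₂', hc'⟩ := Ideal.mem_span_pair.mp hw'mem
  have hz' : z' = z + c₁ * x + c₂ * y := by
    have : z' = z + (c₁ * x + c₂ * y) := by rw [hc]; ring
    rw [this]; ring
  have hw' : w' = w + c₁' * x + c₂' * y := by
    have : w' = w + (c₁' * x + c₂' * y) := by rw [hc']; ring
    rw [this]; ring
  obtain ⟨hspan', -, Ψ', hΨ', hroot', hfΨ'⟩ := hAst'
  obtain ⟨hα, hβ, hAl', hBe', -, hnd'⟩ := hprep'
  have ht' : IsRsopPart ![x, y, z', w'] := isRsopPart_four hreg hdim hspan'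
  have hf'd : f' ∈ maximalIdeal S ^ d := mem_pow_of_cone hspan' hd hΨ' hfΨ'
  have hf'q : f' = f + x ^ a * y ^ b * q ^ 2 := by rw [hf', hu]
  -- ### frame correction: the `y`-coefficients are non-units
  have h02 : BetaGe x y z' w' d 0 2 f' :=
    betaGe_zero_two_of_vStar ht' (vStar_pos_or_two_le hVf (betaGe_zero_two_of_nearY ht hnear)) hAl' hBe'
  obtain ⟨hc₂, hc₂'⟩ := frame_yCoeff_mem_maximalIdeal hreg hdim hspan hodd h3 hΨ hroot hfΨ hnear hz' hw'
    (q := q) (by rw [← hf'q]; exact hf'd) (by rw [← hf'q]; exact h02)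
  -- ### the near-point ideal in the frame `t′` and purification
  have hxy : Ideal.span ({x, y} : Set S) ≤ maximalIdeal S := by
    rw [← hspan]; exact Ideal.span_mono (by intro s hs; simp only [Set.mem_insert_iff, Set.mem_singleton_iff] at hs ⊢; tauto)
  have hym : y ∈ maximalIdeal S := hxy (Ideal.subset_span (by simp))
  have hfG : f ∈ Ideal.span (uPow ![x, y, z, w] '' {e | 2 * d ≤ 2 * e 0 + e 1 + 2 * e 2 + 2 * e 3}) :=
    mem_of_forall_minExponents_uPow_mem ht fun e he => uPow_mem_span_uPow _ ((weight_iff_nearY d e).mpr (hnear e he))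
  have hF1 := maximalIdeal_le_weightIdeal_one hspan'
  have hyW := hF1 hym
  have hxW := param_mem_weightIdeal_two x y z' w' (l := 0) (by decide)
  have hzW : z ∈ Ideal.span (uPow ![x, y, z', w'] '' {e | 2 ≤ 2 * e 0 + e 1 + 2 * e 2 + 2 * e 3}) := by
    have : z = z' - c₁ * x - c₂ * y := by rw [hz']; ring
    rw [this]
    refine sub_mem (sub_mem (param_mem_weightIdeal_two x y z' w' (l := 2) (by decide)) (Ideal.mul_mem_left _ _ hxW)) ?_
    exact weightIdeal_mul_le _ 1 1 (Ideal.mul_mem_mul (hF1 hc₂) hyW)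
  have hwW : w ∈ Ideal.span (uPow ![x, y, z', w'] '' {e | 2 ≤ 2 * e 0 + e 1 + 2 * e 2 + 2 * e 3}) := by
    have : w = w' - c₁' * x - c₂' * y := by rw [hw']; ring
    rw [this]
    refine sub_mem (sub_mem (param_mem_weightIdeal_two x y z' w' (l := 3) (by decide)) (Ideal.mul_mem_left _ _ hxW)) ?_
    exact weightIdeal_mul_le _ 1 1 (Ideal.mul_mem_mul (hF1 hc₂') hyW)
  have hfG' := span_uPow_weight_le_of_frame ![x, y, z', w'] hxW hyW hzW hwW (2 * d) hfG
  have hε : uPow ![x, y, z', w'] ![a, b, 0, 0] = x ^ a * y ^ b := by rw [uPow_four]; simp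
  have hBq : BetaGe x y z' w' d α β (f + uPow ![x, y, z', w'] ![a, b, 0, 0] * q ^ 2) := by
    rw [hε, ← hf'q]; exact hBe'
  obtain ⟨q'', r, hG'', hBe'', hfrel⟩ := exists_purified ht' hα hβ ![a, b, 0, 0] hfG' hBq
  rw [hε] at hG'' hBe'' hfrel
  obtain ⟨f'', hf''⟩ : ∃ f'' : S, f'' = f + x ^ a * y ^ b * q'' ^ 2 := ⟨_, rfl⟩
  rw [← hf''] at hG'' hBe'' hfrel
  have hfrel' : f'' = f' + u * r ^ 2 := by rw [hfrel, hf'q, hu]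
  -- ### `f″` is prepared and an arithmetic stage datum in the frame `(z′, w′)`
  have hsqadd : ∀ q₂ : S, f' + u * (r + q₂) ^ 2 = f'' + u * q₂ ^ 2 := by
    intro q₂; rw [hfrel', add_sq]; linear_combination (u * r * q₂) * h2
  have hnGt'' : ¬ BetaGt x y z' w' d α β f'' := fun h => hnd' (Or.inl ⟨r, by rw [← hfrel']; exact h⟩)
  have hnd'' : ¬ IsDissolvableTwAt u x y z' w' d α β f'' := by
    rintro (⟨q₂, h⟩ | ⟨aa, bb, hab, e₁, e₂, q₂, h⟩)
    · exact hnd' (Or.inl ⟨r + q₂, by rw [hsqadd]; exact h⟩)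
    · exact hnd' (Or.inr ⟨aa, bb, hab, e₁, e₂, r + q₂, by rw [hsqadd]; exact h⟩)
  have hAl'' : AlphaGe x z' w' d α f'' := by
    refine (alphaGe_iff_forall_minExponents ht' hα _).mpr fun e he => ?_
    rcases (betaGe_iff_forall_minExponents ht' hα hβ _).mp hBe'' e he with h | h | ⟨h, -⟩
    · exact Or.inl h
    · exact Or.inr ((Nat.ceil_le_floor_add_one _).trans h)
    · exact Or.inr h
  have hprep'' : IsPreparedTwAt u x y z' w' d α β f'' := ⟨hα, hβ, hAl'', hBe'', hnGt'', hnd''⟩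
  have hf''d : f'' ∈ maximalIdeal S ^ d := by
    refine (Ideal.span_le.mpr ?_) hG''
    rintro _ ⟨e, he, rfl⟩
    simp only [Set.mem_setOf_eq] at he
    rw [SetLike.mem_coe, ← hspan', span_four_pow_eq_span_uPow]
    refine uPow_mem_span_uPow _ ?_
    simp only [Set.mem_setOf_eq, sum_four]; omega
  have hur : u * r ^ 2 ∈ Ideal.span {x, y} * maximalIdeal S ^ (d - 1) ⊔ maximalIdeal S ^ (d + 1) := by
    have hmem : uPow ![x, y, z', w'] ![a, b, 0, 0] * r ^ 2 ∈ maximalIdeal S ^ d := by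
      rw [hε, ← hu]
      have : u * r ^ 2 = f'' - f' := by rw [hfrel']; ring
      rw [this]; exact sub_mem hf''d hf'd
    have := twistedSq_mem_coneCorrection ht' hspan' hodd (ε := ![a, b, 0, 0]) (by simp) (by simp) hmem
    rwa [hε, ← hu] at this
  have hfΨ'' : f'' - eval ![z', w'] Ψ' ∈ Ideal.span {x, y} * maximalIdeal S ^ (d - 1) ⊔ maximalIdeal S ^ (d + 1) := by
    have : f'' - eval ![z', w'] Ψ' = (f' - eval ![z', w'] Ψ') + u * r ^ 2 := by rw [hfrel']; ring
    rw [this]; exact add_mem hfΨ' hur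
  have hAst'' : IsArithStage S x y z' w' u f'' d := ⟨hspan', ⟨a, b, ha, hb, hu⟩, Ψ', hΨ', hroot', hfΨ''⟩
  -- ### the downstairs frame
  obtain ⟨e₂, he₂⟩ := exists_map_eq_mul_of_mem_maximalIdeal φ hspan hx hz hw hc₂
  obtain ⟨e₂', he₂'⟩ := exists_map_eq_mul_of_mem_maximalIdeal φ hspan hx hz hw hc₂'
  obtain ⟨z₁'', hz₁''⟩ : ∃ z₁'' : S₁, z₁'' = z₁ + (φ c₁ * x₁ + φ y * e₂) := ⟨_, rfl⟩
  obtain ⟨w₁'', hw₁''⟩ : ∃ w₁'' : S₁, w₁'' = w₁ + (φ c₁' * x₁ + φ y * e₂') := ⟨_, rfl⟩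
  have hz'' : φ z' = φ y * z₁'' := by
    rw [hz', map_add, map_add, map_mul, map_mul, hz, hx, he₂, hz₁'']; ring
  have hw'' : φ w' = φ y * w₁'' := by
    rw [hw', map_add, map_add, map_mul, map_mul, hw, hx, he₂', hw₁'']; ring
  have hδmem : ∀ c e : S₁, c * x₁ + φ y * e ∈ Ideal.span ({x₁, φ y} : Set S₁) := fun c e =>
    add_mem (Ideal.mul_mem_left _ _ (Ideal.subset_span (by simp))) (Ideal.mul_mem_right _ _ (Ideal.subset_span (by simp)))
  have hspan₁'' : Ideal.span {x₁, φ y, z₁'', w₁''} = maximalIdeal S₁ := by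
    rw [hz₁'', hw₁'', span_four_move_eq x₁ (φ y) z₁ w₁ (hδmem _ _) (hδmem _ _), hspan₁]
  have ht₁'' : IsRsopPart ![x₁, φ y, z₁'', w₁''] := isRsopPart_four hreg₁ hdim₁ hspan₁''
  have hY'' : IsYChartHat φ σ σ₁ x y z' w' x₁ z₁'' w₁'' := ⟨hσ, hσ₁, hcompat, hsurj, hspan₁'', hx, hz'', hw''⟩
  -- ### the downstairs element: the transform of the cleaning is a cleaning
  obtain ⟨g'', hg''⟩ := exists_strictTransform φ hx hz'' hw'' (d := d) (f := f'') (by rw [hspan']; exact hf''d)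
  have hg''f : g'' * φ y ^ d = φ (f + x ^ a * y ^ b * q'' ^ 2) := by rw [← hf'', hg'', mul_comm]
  have hab : a + b ≤ d := by omega
  obtain ⟨q₁'', hq₁''⟩ := strictTransform_cleaning_eq φ ht₁ hx hk hb₁ hab hf hg''f
  have hg''u : g'' = f₁ + u₁ * q₁'' ^ 2 := by rw [hq₁'', hu₁, ha₁a]
  have hrad'' : φ (u * f'') = φ y ^ (2 * k) * (u₁ * g'') := by
    have hpow : φ y ^ a * φ y ^ b * φ y ^ d = φ y ^ (2 * k) * φ y ^ b₁ := by
      rw [← pow_add, ← pow_add, ← pow_add, hk]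
    rw [map_mul, hg'', hu, hu₁, ha₁a, map_mul, map_pow, map_pow, hx]
    calc (φ y * x₁) ^ a * φ y ^ b * (φ y ^ d * g'') = x₁ ^ a * g'' * (φ y ^ a * φ y ^ b * φ y ^ d) := by ring
      _ = x₁ ^ a * g'' * (φ y ^ (2 * k) * φ y ^ b₁) := by rw [hpow]
      _ = φ y ^ (2 * k) * (x₁ ^ a * φ y ^ b₁ * g'') := by ring
  -- ### the downstairs arithmetic stage datum
  have hg''d : g'' ∈ maximalIdeal S₁ ^ d := by
    refine strictTransform_mem_pow_of_nearY φ ht' ht₁'' hspan' hspan₁'' hx hz'' hw'' hf''d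
      (by rw [hg'', mul_comm]) fun e he => ?_
    obtain ⟨g₀, hg₀, hle⟩ := exists_le_of_mem_span_uPow ht' hG'' he
    simp only [Set.mem_setOf_eq] at hg₀
    have k0 : g₀ 0 ≤ e 0 := hle 0; have k1 : g₀ 1 ≤ e 1 := hle 1
    have k2 : g₀ 2 ≤ e 2 := hle 2; have k3 : g₀ 3 ≤ e 3 := hle 3
    exact (weight_iff_nearY d e).mp (by omega)
  -- the cone clause of `g″` in the frame `(z₁″, w₁″)`
  have hx₁y : Ideal.span ({x₁, φ y} : Set S₁) ≤ maximalIdeal S₁ := by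
    rw [← hspan₁]
    exact Ideal.span_mono (Set.insert_subset_insert (Set.singleton_subset_iff.mpr (Set.mem_insert _ _)))
  have hz₁m : z₁ ∈ maximalIdeal S₁ := by rw [← hspan₁]; exact Ideal.subset_span (by simp)
  have hw₁m : w₁ ∈ maximalIdeal S₁ := by rw [← hspan₁]; exact Ideal.subset_span (by simp)
  have hz₁''m : z₁'' ∈ maximalIdeal S₁ := by rw [hz₁'']; exact add_mem hz₁m (hx₁y (hδmem _ _))
  have hw₁''m : w₁'' ∈ maximalIdeal S₁ := by rw [hw₁'']; exact add_mem hw₁m (hx₁y (hδmem _ _))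
  have hdz : z₁ - z₁'' ∈ Ideal.span ({x₁, φ y} : Set S₁) := by
    rw [hz₁'', sub_add_cancel_left]; exact neg_mem (hδmem _ _)
  have hdw : w₁ - w₁'' ∈ Ideal.span ({x₁, φ y} : Set S₁) := by
    rw [hw₁'', sub_add_cancel_left]; exact neg_mem (hδmem _ _)
  have hΨtr : eval ![z₁, w₁] Ψ₁ - eval ![z₁'', w₁''] Ψ₁ ∈ Ideal.span {x₁, φ y} * maximalIdeal S₁ ^ (d - 1) := by
    refine eval_sub_eval_mem_mul_pow hΨ₁ (by omega) (a := ![z₁, w₁]) (b := ![z₁'', w₁'']) ?_ ?_ ?_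
    · intro i; fin_cases i
      · exact hdz
      · exact hdw
    · intro i; fin_cases i
      · exact hz₁m
      · exact hw₁m
    · intro i; fin_cases i
      · exact hz₁''m
      · exact hw₁''m
  have hε₁ : uPow ![x₁, φ y, z₁'', w₁''] ![a₁, b₁, 0, 0] = u₁ := by rw [uPow_four, hu₁]; simp
  have hu₁sq : u₁ * q₁'' ^ 2 ∈ Ideal.span {x₁, φ y} * maximalIdeal S₁ ^ (d - 1) ⊔ maximalIdeal S₁ ^ (d + 1) := by
    have hmem : uPow ![x₁, φ y, z₁'', w₁''] ![a₁, b₁, 0, 0] * q₁'' ^ 2 ∈ maximalIdeal S₁ ^ d := by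
      rw [hε₁]
      have : u₁ * q₁'' ^ 2 = g'' - f₁ := by rw [hg''u]; ring
      rw [this]; exact sub_mem hg''d hf₁d
    have := twistedSq_mem_coneCorrection ht₁'' hspan₁'' hodd (ε := ![a₁, b₁, 0, 0]) (by simp) (by simp) hmem
    rwa [hε₁] at this
  have hcone₁'' : g'' - eval ![z₁'', w₁''] Ψ₁ ∈
      Ideal.span {x₁, φ y} * maximalIdeal S₁ ^ (d - 1) ⊔ maximalIdeal S₁ ^ (d + 1) := by
    have hsum := add_mem (add_mem hfΨ₁ (Ideal.mem_sup_left hΨtr)) hu₁sq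
    have hsplit : g'' - eval ![z₁'', w₁''] Ψ₁ =
        (f₁ - eval ![z₁, w₁] Ψ₁) + (eval ![z₁, w₁] Ψ₁ - eval ![z₁'', w₁''] Ψ₁) + u₁ * q₁'' ^ 2 := by
      rw [hg''u]; ring
    rw [hsplit]; exact hsum
  have hAst₁'' : IsArithStage S₁ x₁ (φ y) z₁'' w₁'' u₁ g'' d :=
    ⟨hspan₁'', ⟨a₁, b₁, ha₁, hb₁, hu₁⟩, Ψ₁, hΨ₁, hroot₁, hcone₁''⟩
  -- ### transfer, read, transport
  have hprep₁ := hII S S₁ φ σ σ₁ x y z' w' u f'' x₁ z₁'' w₁'' u₁ g'' d k α β hS hS₁ hodd h3 hAst'' hY'' hrad''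
    hAst₁'' hprep''
  have hV₁'' := hV S₁ x₁ (φ y) z₁'' w₁'' u₁ g'' d α (α + β - 1) hS₁ hodd h3 hAst₁'' hprep₁
  have hrep₁ : IsGaugeRepTw u₁ x₁ (φ y) z₁ w₁ f₁ z₁'' w₁'' g'' := by
    refine ⟨?_, ?_, q₁'', hg''u⟩
    · rw [hz₁'', add_sub_cancel_left]; exact hδmem _ _
    · rw [hw₁'', add_sub_cancel_left]; exact hδmem _ _
  obtain ⟨e1, e2⟩ := isVStarTw_unique ((isVStarTw_iff_of_isGaugeRepTw hrep₁ d α (α + β - 1)).mp hV₁'') hV₁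
  exact ⟨e1, e2.le⟩

end Summit.ResolutionOfSingularities.ResolutionOfSingularities.Theorems.SwitchingDichotomy.BetaHat

end
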